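import Summits.ResolutionOfSingularities.ResolutionOfSingularities.Theorems.ConeJumpChart
import Literature.AlgebraicGeometry.Resolution.PrimeDivisorIdealsIntersection
import Literature.AlgebraicGeometry.Resolution.GenericPointStalkData

/-!
# ConeJumpFrame — a uniformly flat curve on a regular scheme: frames at its closed points, regularity of the
reduced curve, and the frame at the generic point `η` (`etaFrame`)

Slice 3/4 of the node «JumpCut» (`decomp-res-lens-2` g30; engine letter `CurveLeafExit.NormalConeJumpExit`,
proved in slice 4/4 `MaxContactCutConeJump`).  Scheme-level lemmas over the tree's `IsFlatOneAt` / `IsCurvePt` /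
`curvePrime`:

* `flat_stalkIdeal_le` — at a flat closed point `I_y ⊆ 𝔓ⁿ` and `𝔓 ⊆ 𝔪` (`𝔓` the curve prime);
* `isRsopPart_of_isFlatOneAt` — the frame `c` of a flat point is part of a regular system of parameters
  (`(c, v) = 𝔪`, `spanFinrank 𝔪 = 3`, `isRsopPart_comp_of_rsop`);
* `isRegular_flatCurve_subscheme` — the reduced curve `V(𝓘_{closure {η}})` of a uniformly flat curve is a regular
  scheme (`isRegular_subscheme_vanishingIdeal_closure_of_forall`; at `η` the residue field);
* `etaFrame` — THE FRAME AT `η`: in `𝒪_η = (𝒪_{y₀})_𝔓` (`isLocalizationAtPrime_stalkSpecializes`) the images of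
  `c` form a quasi-regular pair generating `𝔪_η` (`IsRsopPart.map_of_le_prime`), `μ = λ v` is a unit
  (`v ∉ 𝔓`, else `𝔓 = 𝔪_{y₀}` and `η = y₀` by `primeOfSpecializes_injective`), `c₀ⁿ + μ c₁ⁿ + g' ∈ I_η` with
  `g' ∈ 𝔪_ηⁿ⁺¹`, and over `κ(η) = Frac(𝒪_{y₀}/𝔓)` (a Noetherian local domain with principal maximal ideal
  `(v̄)`; `IsFractionRing` from the localisation-of-quotient instance) both `Xⁿ + μ̄` (Eisenstein,
  `irreducible_X_pow_add_C_of_uniformizer`) and `μ̄ Xⁿ + 1` (`irreducible_C_mul_X_pow_add_one`) are irreducible.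

Sources: [Hironaka1964] Ch. III §§1–3; [CossartJannsenSaito2020] Ch. 2, Ch. 8; [CossartPiltant2008] Prop. 4.2 (a);
[Matsumura1987] Thms. 14.2, 16.2.
-/

open IsLocalRing Polynomial
open Literature.AlgebraicGeometry.Resolution

namespace Summit.ResolutionOfSingularities.ResolutionOfSingularities.Theorems.ConeJump

/-! ## §7  The flat curve on a regular scheme: frames at its points, regularity of the centre, the frame at `η` -/

section SchemeLevel

open CategoryTheory AlgebraicGeometry TopologicalSpace Topology
open Summit.ResolutionOfSingularities.ResolutionOfSingularities.Theorems
open Summit.ResolutionOfSingularities.ResolutionOfSingularities.Theorems.WeakOrderReduction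
open Summit.ResolutionOfSingularities.ResolutionOfSingularities.Theorems.RelativeDeltaCut
open Summit.ResolutionOfSingularities.ResolutionOfSingularities.Theorems.CurveLeafExit

variable {Y : Scheme.{0}}

/-- **At a flat closed point the ideal is `n`-deep along the curve prime**: `𝓘_y ⊆ 𝔓ⁿ` and `𝔓 ⊆ 𝔪`. [folklore] -/
theorem flat_stalkIdeal_le (I : Y.IdealSheafData) {n : ℕ} {η y : Y} (hfl : IsFlatOneAt I n η y) :
    ∃ h : η ⤳ y, stalkIdeal I y ≤ curvePrime h ^ n ∧ curvePrime h ≤ maximalIdeal (Y.presheaf.stalk y) := by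
  obtain ⟨h, c, v, lam, g, hP, hW', -, -, -, -, hJ⟩ := hfl
  refine ⟨h, by rw [← hP]; exact hJ, ?_⟩
  rw [← hP, ← hW']
  exact Ideal.span_mono Set.subset_union_left

/-- **The curve prime at a flat closed point is generated by part of a regular system of parameters** (`c`
extends by `v` to a minimal basis of `𝔪`). [folklore] -/
theorem isRsopPart_of_isFlatOneAt [IsLocallyNoetherian Y] (hY : Scheme.IsRegular Y) (I : Y.IdealSheafData)
    {n : ℕ} {η y : Y} (hfl : IsFlatOneAt I n η y) :
    ∃ (h : η ⤳ y) (c : Fin 2 → Y.presheaf.stalk y), Ideal.span (Set.range c) = curvePrime h ∧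
      @IsRsopPart _ _ (hY y).toIsLocalRing 2 c := by
  haveI := hY y
  obtain ⟨h, c, v, lam, g, hP, hW', hd, -, -, -, -⟩ := hfl
  have hW : Ideal.span (Set.range (Fin.append c ![v])) = maximalIdeal _ := by
    rw [← hW', range_fin_append, Matrix.range_cons, Matrix.range_empty, Set.union_empty]
  refine ⟨h, c, hP, ?_⟩
  have := isRsopPart_comp_of_rsop hd (Fin.append c ![v]) hW (Fin.castAdd 1) (Fin.castAdd_injective _ _)
  convert this using 1
  funext i
  simp [Fin.append_left]

/-- **The reduced curve `cl{η}` of a uniformly flat curve is a regular scheme**: at a closed point its local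
ring is `𝒪_{Y,y}/(c)` with `c` part of a regular system of parameters, at `η` it is the residue field.
[folklore] -/
theorem isRegular_flatCurve_subscheme [IsLocallyNoetherian Y] (hY : Scheme.IsRegular Y)
    (I : Y.IdealSheafData) {n : ℕ} {η : Y} (hcurve : IsCurvePt η)
    (hflat : ∀ y : Y, η ⤳ y → IsClosed ({y} : Set Y) → IsFlatOneAt I n η y) :
    Scheme.IsRegular
      (Scheme.IdealSheafData.vanishingIdeal (⟨closure ({η} : Set Y), isClosed_closure⟩ : Closeds Y)).subscheme := by
  refine isRegular_subscheme_vanishingIdeal_closure_of_forall fun z hz => ?_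
  by_cases hzη : z = η
  · subst hzη
    exact isRegularLocalRing_stalk_quotient_primeOfSpecializes_self z
  · haveI := hY z
    obtain ⟨h, c, hP, hc⟩ := isRsopPart_of_isFlatOneAt hY I (hflat z hz (hcurve.2 z hz hzη))
    change IsRegularLocalRing (Y.presheaf.stalk z ⧸ curvePrime h)
    rw [← hP]
    exact hc.isRegularLocalRing_quotient

/-- **THE FRAME AT THE GENERIC POINT `η`.**  From a flat frame at a closed point `y₀ ≠ η` of the curve: in
`𝒪_{Y,η} = (𝒪_{Y,y₀})_𝔓` the images `c'` of `c` form a quasi-regular system generating `𝔪_η = 𝓘_{C,η}`,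
`μ = λ v` is a UNIT, `f_η = c₀'ⁿ + μ c₁'ⁿ + g'` with `g' ∈ 𝔪_ηⁿ⁺¹` lies in `𝓘_η`, and over the residue field
`κ(η) = Frac(𝒪_{y₀}/𝔓)` — the fraction field of a Noetherian local domain with principal maximal ideal `(v̄)`
in which `μ̄ = λ̄ v̄` is a unit times the uniformizer — both `Xⁿ + μ̄` (Eisenstein, §3) and `μ̄ Xⁿ + 1`
(reflection, §2) are irreducible.  (`v ∉ 𝔓` because `𝔓 = 𝔪_{y₀}` would force `η = y₀`,
`primeOfSpecializes_injective`.) [folklore] -/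
theorem etaFrame [IsLocallyNoetherian Y] (hY : Scheme.IsRegular Y) (C₀ I : Y.IdealSheafData) {n : ℕ}
    (hn : 0 < n) {η y₀ : Y} (hy₀η : y₀ ≠ η)
    (hCη : stalkIdeal C₀ η = maximalIdeal (Y.presheaf.stalk η)) (hfl : IsFlatOneAt I n η y₀) :
    ∃ (c' : Fin 2 → Y.presheaf.stalk η) (μ g' : Y.presheaf.stalk η) (I₀ : Ideal (Y.presheaf.stalk η)),
      IsQuasiRegular c' ∧ Ideal.span (Set.range c') = maximalIdeal _ ∧
      Ideal.span (Set.range c') = stalkIdeal C₀ η ∧ Ideal.span (Set.range c') = I₀ ∧ IsUnit μ ∧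
      g' ∈ Ideal.span (Set.range c') ^ (n + 1) ∧ c' 0 ^ n + μ * c' 1 ^ n + g' ∈ stalkIdeal I η ∧
      Irreducible ((Polynomial.X ^ n + Polynomial.C μ).map (Ideal.Quotient.mk I₀)) ∧
      Irreducible ((Polynomial.C μ * Polynomial.X ^ n + 1).map (Ideal.Quotient.mk I₀)) := by
  classical
  haveI := hY y₀
  obtain ⟨h, c, v, lam, g, hP, hW', hd, hlam, hg, hf, -⟩ := hfl
  have hW : Ideal.span (Set.range (Fin.append c ![v])) = maximalIdeal _ := by
    rw [← hW', range_fin_append, Matrix.range_cons, Matrix.range_empty, Set.union_empty]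
  have hrs : IsRsopPart c := by
    have := isRsopPart_comp_of_rsop hd (Fin.append c ![v]) hW (Fin.castAdd 1) (Fin.castAdd_injective _ _)
    convert this using 1
    funext i
    simp [Fin.append_left]
  haveI hPprime : (curvePrime h).IsPrime := by rw [← hP]; exact hrs.isPrime_span_range
  -- `𝒪_η` is the localisation of `A = 𝒪_{y₀}` at the curve prime `P = (c)`
  letI := (Y.presheaf.stalkSpecializes h).hom.toAlgebra
  haveI hloc : IsLocalization.AtPrime (Y.presheaf.stalk η) (curvePrime h) :=
    isLocalizationAtPrime_stalkSpecializes h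
  have halg : algebraMap (Y.presheaf.stalk y₀) (Y.presheaf.stalk η) = (Y.presheaf.stalkSpecializes h).hom :=
    RingHom.algebraMap_toAlgebra _
  have hq : ∀ i, c i ∈ curvePrime h := fun i => by rw [← hP]; exact Ideal.subset_span ⟨i, rfl⟩
  -- `v ∉ P` (else `P = 𝔪_{y₀}` and `η = y₀`) and `λ ∉ P`, so `μ = λ v` is a unit at `η`
  have hvP : v ∉ curvePrime h := fun hv => by
    have hle : maximalIdeal (Y.presheaf.stalk y₀) ≤ curvePrime h := by
      rw [← hW', Ideal.span_le]
      rintro x (⟨i, rfl⟩ | hx)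
      · exact hq i
      · rw [Set.mem_singleton_iff.mp hx]; exact hv
    have heq : curvePrime h = maximalIdeal _ :=
      ((maximalIdeal.isMaximal _).eq_of_le hPprime.ne_top hle).symm
    have heq' : primeOfSpecializes h = primeOfSpecializes (specializes_refl y₀) := by
      rw [primeOfSpecializes_refl]; exact heq
    exact hy₀η (primeOfSpecializes_injective h (specializes_refl y₀) heq').symm
  have hlamP : lam ∉ curvePrime h := fun hl => hPprime.ne_top (Ideal.eq_top_of_isUnit_mem _ hl hlam)
  have hlvP : lam * v ∉ curvePrime h := fun hm => (hPprime.mem_or_mem hm).elim hlamP hvP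
  have hμ : IsUnit (algebraMap (Y.presheaf.stalk y₀) (Y.presheaf.stalk η) (lam * v)) :=
    IsLocalRing.notMem_maximalIdeal.mp fun hm => hlvP
      ((IsLocalization.AtPrime.to_map_mem_maximal_iff (Y.presheaf.stalk η) (curvePrime h) (lam * v)).mp hm)
  -- the frame `c` read in `𝒪_η`
  have hPc : (Ideal.span (Set.range c)).map (algebraMap (Y.presheaf.stalk y₀) (Y.presheaf.stalk η)) =
      Ideal.span (Set.range fun i => algebraMap (Y.presheaf.stalk y₀) (Y.presheaf.stalk η) (c i)) := by
    rw [Ideal.map_span, ← Set.range_comp]; rfl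
  have hcm : Ideal.span (Set.range fun i => algebraMap (Y.presheaf.stalk y₀) (Y.presheaf.stalk η) (c i)) =
      maximalIdeal _ := by
    rw [← hPc, hP]; exact IsLocalization.AtPrime.map_eq_maximalIdeal (curvePrime h) (Y.presheaf.stalk η)
  have hrs' := hrs.map_of_le_prime (curvePrime h) hq (Y.presheaf.stalk η)
  have hIη : stalkIdeal I η =
      (stalkIdeal I y₀).map (algebraMap (Y.presheaf.stalk y₀) (Y.presheaf.stalk η)) := by
    rw [halg, stalkIdeal_map_stalkSpecializes]
  -- `D = 𝒪_{y₀}/P`: a Noetherian local domain with maximal ideal `(v̄)`; `𝒪_η/P𝒪_η = Frac D`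
  haveI : IsLocalRing (Y.presheaf.stalk y₀ ⧸ curvePrime h) :=
    IsLocalRing.of_surjective' (Ideal.Quotient.mk _) Ideal.Quotient.mk_surjective
  haveI hPmax : ((curvePrime h).map (algebraMap (Y.presheaf.stalk y₀) (Y.presheaf.stalk η))).IsMaximal := by
    rw [IsLocalization.AtPrime.map_eq_maximalIdeal (curvePrime h) (Y.presheaf.stalk η)]
    exact maximalIdeal.isMaximal _
  letI : Field (Y.presheaf.stalk η ⧸
      (curvePrime h).map (algebraMap (Y.presheaf.stalk y₀) (Y.presheaf.stalk η))) := Ideal.Quotient.field _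
  have hM : Algebra.algebraMapSubmonoid (Y.presheaf.stalk y₀ ⧸ curvePrime h) (curvePrime h).primeCompl =
      nonZeroDivisors (Y.presheaf.stalk y₀ ⧸ curvePrime h) := by
    ext x
    simp only [Algebra.algebraMapSubmonoid, Submonoid.mem_map, mem_nonZeroDivisors_iff_ne_zero,
      Ideal.Quotient.algebraMap_eq]
    constructor
    · rintro ⟨a, ha, rfl⟩ h0
      exact ha (Ideal.Quotient.eq_zero_iff_mem.mp h0)
    · intro hx
      obtain ⟨a, rfl⟩ := Ideal.Quotient.mk_surjective x
      exact ⟨a, fun ha => hx (Ideal.Quotient.eq_zero_iff_mem.mpr ha), rfl⟩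
  haveI : IsFractionRing (Y.presheaf.stalk y₀ ⧸ curvePrime h)
      (Y.presheaf.stalk η ⧸ (curvePrime h).map (algebraMap (Y.presheaf.stalk y₀) (Y.presheaf.stalk η))) := by
    have hinst : IsLocalization
        (Algebra.algebraMapSubmonoid (Y.presheaf.stalk y₀ ⧸ curvePrime h) (curvePrime h).primeCompl)
        (Y.presheaf.stalk η ⧸ (curvePrime h).map (algebraMap (Y.presheaf.stalk y₀) (Y.presheaf.stalk η))) :=
      inferInstance
    rwa [hM] at hinst
  have hw : maximalIdeal (Y.presheaf.stalk y₀ ⧸ curvePrime h) =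
      Ideal.span {Ideal.Quotient.mk (curvePrime h) v} := by
    have h1 : (maximalIdeal (Y.presheaf.stalk y₀)).map (Ideal.Quotient.mk (curvePrime h)) =
        Ideal.span {Ideal.Quotient.mk (curvePrime h) v} := by
      rw [← hW', Ideal.span_union, Ideal.map_sup, hP, Ideal.map_quotient_self, bot_sup_eq, Ideal.map_span,
        Set.image_singleton]
    rcases Ideal.map_eq_top_or_isMaximal_of_surjective (f := Ideal.Quotient.mk (curvePrime h))
        Ideal.Quotient.mk_surjective (maximalIdeal.isMaximal (Y.presheaf.stalk y₀)) with htop | hmax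
    · exact absurd (top_le_iff.mp (htop ▸ map_mk_maximalIdeal_le (curvePrime h)))
        (maximalIdeal.isMaximal _).ne_top
    · rw [← h1]; exact (IsLocalRing.eq_maximalIdeal hmax).symm
  have hw0 : Ideal.Quotient.mk (curvePrime h) v ≠ 0 := fun h0 => hvP (Ideal.Quotient.eq_zero_iff_mem.mp h0)
  -- Eisenstein at `P`: `Xⁿ + μ̄` is irreducible over `κ(η)`; so is its reflection `μ̄ Xⁿ + 1`
  have hE := irreducible_X_pow_add_C_of_uniformizer
    (K := Y.presheaf.stalk η ⧸ (curvePrime h).map (algebraMap (Y.presheaf.stalk y₀) (Y.presheaf.stalk η)))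
    hw hw0 (hlam.map (Ideal.Quotient.mk (curvePrime h))) hn
  rw [← map_mul, Ideal.Quotient.algebraMap_quotient_map_quotient] at hE
  have hμ0 : Ideal.Quotient.mk ((curvePrime h).map (algebraMap (Y.presheaf.stalk y₀) (Y.presheaf.stalk η)))
      (algebraMap (Y.presheaf.stalk y₀) (Y.presheaf.stalk η) (lam * v)) ≠ 0 := fun h0 => by
    rw [Ideal.Quotient.eq_zero_iff_mem,
      IsLocalization.AtPrime.map_eq_maximalIdeal (curvePrime h) (Y.presheaf.stalk η)] at h0
    exact (IsLocalRing.notMem_maximalIdeal.mpr hμ) h0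
  have hE' := irreducible_C_mul_X_pow_add_one hn hμ0 hE
  refine ⟨fun i => algebraMap _ _ (c i), algebraMap _ _ (lam * v), algebraMap _ _ g,
    (curvePrime h).map (algebraMap (Y.presheaf.stalk y₀) (Y.presheaf.stalk η)),
    hrs'.isQuasiRegular, hcm, hcm.trans hCη.symm, by rw [← hPc, hP], hμ, ?_, ?_, ?_, ?_⟩
  · have := Ideal.mem_map_of_mem (algebraMap (Y.presheaf.stalk y₀) (Y.presheaf.stalk η)) hg
    rwa [Ideal.map_pow, hPc] at this
  · rw [hIη]
    have := Ideal.mem_map_of_mem (algebraMap (Y.presheaf.stalk y₀) (Y.presheaf.stalk η)) hf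
    simpa only [map_add, map_mul, map_pow] using this
  · simpa only [Polynomial.map_add, Polynomial.map_pow, Polynomial.map_X, Polynomial.map_C] using hE
  · simpa only [Polynomial.map_add, Polynomial.map_mul, Polynomial.map_pow, Polynomial.map_X,
      Polynomial.map_C, Polynomial.map_one] using hE'

end SchemeLevel

end Summit.ResolutionOfSingularities.ResolutionOfSingularities.Theorems.ConeJump
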